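import Summits.BirchSwinnertonDyer.Rank1Residual.ManinAdditive.TwistOrbitIndexEngineOdd
import HarnessLib
import HarnessLib.Audit.Tags

/-!
# §25 THE ISOGENY-DEGREE READING OF A FLIP (E-an-29 `RamifiedTwistFlipIsogenyDegree` + `_holds`;
# E-an-30 `RamifiedTwistCommutesOffMazurPrimes` + `_holds`, Mazur–Kenku inside the statement) — cell `bsd-f2-manin`

Cell `bsd-f2-manin` (D-0131 (3) frontier: the Manin constant at additive primes), analytic lens
(planner `bsd-f2-manin-an` g5), typed VERBATIM by the cell typer from HOME `run/shared/lean/pub/bsd-f2-manin/an/Sec24Core-g5.lean` sha16 9ed34f9b51be5933 (1181 lines, §24–§26 of the cumulative HOME `an/Sketch-an6.lean` bd37945ff22921ca over TREE imports only; farm rc 0 · 0 errors · 0 warnings · 0 sorries; MEMO-an §41–§43; CANDIDATES rows E-an-26…31), split into four chained theorem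
files `TwistOrbitIndexEngine` (§24 core) ← `TwistOrbitIndexEngineOdd` (§24 instances at `d = q*` and the
edge E-imc-2 ⇒ E-imc-7R) ← `TwistOrbitIsogenyDegree` (§25) ← `RamifiedTwistOptimalityCommutesProof` (§26,
the closer of imc's landed leaf E-imc-3b), plus the conjecture-only leaf `CommutingOrbitManinValEq.lean`
(E-an-28's open target). Nothing conjectural is asserted: every open law enters as an explicit hypothesis;
the `@[conjecture]` obligations declared in these files come with their kernel-checked `_holds`.

THIS FILE (source lines 727–1077): on a FLIP orbit every `ℚ`-isogeny `W ⊗ p* → W′` has degree `p·k²`, on a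
commuting orbit every one has SQUARE degree (two rational multipliers of one period lattice into another have
indices in the ratio of their squares); with the tree's named fact `mazurKenku_exists_cyclic_isogeny` taken as a
hypothesis INSIDE the statement, flips live only at the twelve Mazur primes. The planner's mechanism docstring
and BC5 numbers (TWISTCENSUS2 v1 43352cbe215eb58a) follow verbatim.
-/

noncomputable section

open scoped MatrixGroups ModularForm

open CongruenceSubgroup WeierstrassCurve
  Literature.NumberTheory.DiophantineGeometry
  Literature.NumberTheory.EllipticCurves
  Literature.NumberTheory.EllipticCurves.ModularForms

namespace Summit.BirchSwinnertonDyer.Rank1Residual.ManinAdditive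

section CovolumeEngine

open scoped Pointwise

/-! ## §25 THE ISOGENY-DEGREE READING OF A FLIP: on a flip orbit every `ℚ`-isogeny `W ⊗ d → W′` has
## degree `a·k²`, on a commuting orbit every one has SQUARE degree; with Mazur–Kenku, flips live only at
## the twelve Mazur primes — off them Edixhoven's proportionality is a THEOREM.

Mechanism (lattice algebra + one tree theorem + one named fact).  §24 gives on a FLIP orbit the inclusion
`(c′s/c)·Λ_W ⊆ Λ_{W′}` of index exactly `a`, i.e. `r·Λ_T ⊆ Λ_{W′}` with the RATIONAL multiplier
`r = c′d/c` of the Néron-type pair `Λ_T = s⁻¹Λ_W` of `T = W ⊗ d` (Pal's Lemma 3.1, tree).  Any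
`ℚ`-isogeny `φ : T → W′` has a RATIONAL multiplier as well (`φ^*ω′ = αω`, `α ∈ ℚ`): the tree's
`exists_rat_mulLeft_lattice_le_of_isogeny` gives `q·Λ_T ⊆ Λ_{W′}` of index `deg φ`, `q ∈ ℚ`.  For two REAL
multipliers of one lattice into another the indices are in the ratio of the squares (covolumes), so
`deg φ · r² = a · q²`, i.e. `deg φ = a·(q/r)²` with `q/r ∈ ℚ`; an integer of the form `a·x²` (`a` prime,
`x ∈ ℚ`) is `a·k²` with `k ∈ ℕ`.  On a COMMUTING orbit (`u • T = W′`) the Néron-type pair of `W′` is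
`u·Λ_T` (tree `IsNeronLatticeOf.lattice_eq_mulLeft_of_smul`), the same computation with index `1` gives
`deg φ = (q/u)²`, a square.  So «FLIP ⟺ the minimal `ℚ`-isogeny degree between `E_opt ⊗ d` and `E′_opt`
is not a square ⟺ it is `a·k²`».  With the tree's named fact `mazurKenku_exists_cyclic_isogeny` (a cyclic
`ℚ`-isogeny of degree in Kenku's list joins any two `ℚ`-isogenous curves) a flip forces `a ∣ n` for some
`n ∈ kenkuDegrees`, hence `a ∈ mazurPrimes = {2, 3, 5, 7, 11, 13, 17, 19, 37, 43, 67, 163}`: for every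
OTHER prime `q` with `q² ∣ N`, the optimal curve of the `q*`-twisted class is `ℚ`-ISOMORPHIC to the
`q*`-twist of the optimal curve (Edixhoven's 1991 proportionality assertion `Λ̃ ∝ Λ`, which is false in
general — 121a1/121c1 — is TRUE off the Mazur primes), so §23's jump `deg φ′ = q^{±1}·deg φ` and the
Manin-shift reading of §24 hold there with no flip proviso.
BC5 (census TWISTCENSUS2 v1, sha16 43352cbe215eb58a, same-conductor optimal pairs, N ≤ 500 000): the
minimal isogeny degree between `E_opt ⊗ p*` and `E′_opt` is EXACTLY `p` on every flip row (p = 3: 21 774;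
5: 1 542; 7: 122; 11: 74; 17: 20; d = ±2: 45 938 rows) and `1` on every commuting row (1 020 708 rows);
flips occur only at p ∈ {2, 3, 5, 7, 11, 17} ⊂ mazurPrimes.  [cite: SilvermanAEC2009, Thm. VI.4.1(b) and
IX.6 Example 6.4] [cite: Mazur1978, Thm 1] [cite: Kenku1982] [cite: Pal2012, Lemma 3.1]
[cite: Edixhoven1991, §4] -/

/-- Two REAL (here rational) multipliers of one period lattice into another have indices in the ratio of
their squares: `[Λ₂ : qΛ₁]·r² = [Λ₂ : rΛ₁]·q²`. [Mathlib covolumes] -/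
theorem relIndex_ratCast_mul_sq_eq {L₁ L₂ : PeriodPair} {q r : ℚ} (hq : ((q : ℚ) : ℂ) ≠ 0)
    (hr : ((r : ℚ) : ℂ) ≠ 0) (hleq : (L₁.mulLeft _ hq).lattice ≤ L₂.lattice)
    (hler : (L₁.mulLeft _ hr).lattice ≤ L₂.lattice) :
    ((L₁.mulLeft _ hq).lattice.toAddSubgroup.relIndex L₂.lattice.toAddSubgroup : ℝ) * (r : ℝ) ^ 2 =
      ((L₁.mulLeft _ hr).lattice.toAddSubgroup.relIndex L₂.lattice.toAddSubgroup : ℝ) * (q : ℝ) ^ 2 := by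
  have hA := norm_sq_mul_covolume_eq_relIndex_mul hq hleq
  have hB := norm_sq_mul_covolume_eq_relIndex_mul hr hler
  have hnq : ‖((q : ℚ) : ℂ)‖ ^ 2 = (q : ℝ) ^ 2 := by
    rw [← Complex.ofReal_ratCast, Complex.norm_real, Real.norm_eq_abs, sq_abs]
  have hnr : ‖((r : ℚ) : ℂ)‖ ^ 2 = (r : ℝ) ^ 2 := by
    rw [← Complex.ofReal_ratCast, Complex.norm_real, Real.norm_eq_abs, sq_abs]
  rw [hnq] at hA
  rw [hnr] at hB
  have hpos : 0 < ZLattice.covolume L₂.lattice := ZLattice.covolume_pos _ _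
  have key :
      ((L₁.mulLeft _ hq).lattice.toAddSubgroup.relIndex L₂.lattice.toAddSubgroup : ℝ) * (r : ℝ) ^ 2 *
          ZLattice.covolume L₂.lattice =
        ((L₁.mulLeft _ hr).lattice.toAddSubgroup.relIndex L₂.lattice.toAddSubgroup : ℝ) * (q : ℝ) ^ 2 *
          ZLattice.covolume L₂.lattice := by
    linear_combination (-(r : ℝ) ^ 2) * hA + ((q : ℝ) ^ 2) * hB
  exact mul_right_cancel₀ hpos.ne' key

/-- A natural number of the form `a·x²` with `a` prime and `x ∈ ℚ` is `a·k²` with `k ∈ ℕ`. [Mathlib] -/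
theorem nat_eq_prime_mul_sq_of_rat {n a : ℕ} (ha : a.Prime) {x : ℚ} (h : (n : ℚ) = a * x ^ 2) :
    ∃ k : ℕ, n = a * k ^ 2 := by
  have hsq : IsSquare ((n * a : ℕ) : ℚ) := ⟨a * x, by push_cast; rw [h]; ring⟩
  obtain ⟨M, hM⟩ := Rat.isSquare_natCast_iff.mp hsq
  have hdvd : a ∣ M := by
    have hMM : a ∣ M * M := ⟨n, by rw [← hM, mul_comm]⟩
    exact (ha.dvd_mul.mp hMM).elim id id
  obtain ⟨k, rfl⟩ := hdvd
  refine ⟨k, ?_⟩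
  have hk : n * a = (a * k ^ 2) * a := by rw [hM]; ring
  exact Nat.eq_of_mul_eq_mul_right ha.pos hk

/-- A natural number that is the square of a rational is the square of a natural number. [Mathlib] -/
theorem nat_eq_sq_of_rat {n : ℕ} {x : ℚ} (h : (n : ℚ) = x ^ 2) : ∃ k : ℕ, n = k ^ 2 := by
  obtain ⟨k, hk⟩ := Rat.isSquare_natCast_iff.mp ⟨x, by rw [h, sq]⟩
  exact ⟨k, by rw [hk, sq]⟩

/-- **COMMUTING ⇒ SQUARE DEGREES.** If `W′ = u • T` over `ℚ` and `Λ_T` is a Néron-type pair of `T`, every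
`ℚ`-isogeny `T → W′` has square degree: its rational multiplier `q` (tree, *AEC* VI.4.1(b)) maps `Λ_T` into
`Λ_{W′} = u·Λ_T` with index `deg φ = (q/u)²`. [cite: SilvermanAEC2009, Thm. VI.4.1(b) and III.1 Table 3.1] -/
theorem isogeny_degree_eq_sq_of_smul_eq {T W' : WeierstrassCurve ℚ} [T.IsElliptic] [W'.IsElliptic]
    {L L' : PeriodPair} (hL : IsNeronLatticeOf (T.baseChange ℂ) L) (hL' : IsNeronLatticeOf (W'.baseChange ℂ) L')
    (u : VariableChange ℚ) (hu : u • T = W') (φ : Isogeny T W') : ∃ k : ℕ, φ.degree = k ^ 2 := by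
  obtain ⟨q, hq, hle, hidx⟩ := exists_rat_mulLeft_lattice_le_of_isogeny T W' hL hL' φ
  have hL'' : IsNeronLatticeOf ((u • T).baseChange ℂ) L' := by rw [hu]; exact hL'
  have hΛ' := IsNeronLatticeOf.lattice_eq_mulLeft_of_smul u hL hL''
  have hu0 : (((u.u : ℚ) : ℚ) : ℂ) ≠ 0 := by exact_mod_cast u.u.ne_zero
  -- `u·Λ_T ⊆ Λ_{W′}` with index `1`
  have hle1 : (L.mulLeft _ hu0).lattice ≤ L'.lattice := by rw [hΛ']
  have hidx1 : (L.mulLeft _ hu0).lattice.toAddSubgroup.relIndex L'.lattice.toAddSubgroup = 1 := by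
    rw [AddSubgroup.relIndex_eq_one]
    rw [hΛ']
  have key := relIndex_ratCast_mul_sq_eq hq hu0 hle hle1
  rw [hidx, hidx1, Nat.cast_one, one_mul] at key
  -- `deg φ · u² = q²` in `ℝ`, hence in `ℚ`
  have keyQ : (φ.degree : ℚ) * (u.u : ℚ) ^ 2 = q ^ 2 := by exact_mod_cast key
  have huq : ((u.u : ℚ) : ℚ) ≠ 0 := u.u.ne_zero
  exact nat_eq_sq_of_rat (x := q / (u.u : ℚ)) (by rw [div_pow, eq_div_iff (pow_ne_zero 2 huq), keyQ])

/-- **FLIP ⇒ every `ℚ`-isogeny `W ⊗ d → W′` has degree `a·k²`.** Same level, both data lattice-optimal,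
two-sided steps with `‖s‖² = a` prime, `s² = d`, `|aₙ(f′)| = |aₙ(f)|`, and NO `ℚ`-isomorphism
`u • (W ⊗ d) = W′`: then `deg φ = a·k²` for every `ℚ`-isogeny `φ : W ⊗ d → W′` (in particular no such
isogeny has square degree, and the minimal one has degree divisible by `a`).
[cite: SilvermanAEC2009, Thm. VI.4.1(b)] [cite: Pal2012, Lemma 3.1] -/
theorem optimal_flip_isogeny_degree {W W' : WeierstrassCurve ℚ} [W.IsElliptic] [W'.IsElliptic]
    {N N' : ℕ} [NeZero N] [NeZero N'] (hNN : N' = N) (D : ModularParametrizationData W N)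
    (D' : ModularParametrizationData W' N') (hD : IsLatticeOptimal D) (hD' : IsLatticeOptimal D')
    {d : ℚ} (hd : d ≠ 0) {s : ℂ} (hs0 : s ≠ 0) (hs : s ^ 2 = (d : ℂ)) {a : ℕ} (hpr : a.Prime)
    (ha : ‖s‖ ^ 2 = a)
    (h1 : ∀ w ∈ periodLattice D'.f, s * w ∈ periodLattice D.f)
    (h2 : ∀ w ∈ periodLattice D.f, s * w ∈ periodLattice D'.f)
    (hcoef : ∀ n : ℕ, ‖cuspCoeff D'.f n‖ = ‖cuspCoeff D.f n‖)
    (hflip : ∀ u : VariableChange ℚ, u • W.quadraticTwist d ≠ W')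
    (φ : Isogeny (W.quadraticTwist d) W') : ∃ k : ℕ, φ.degree = a * k ^ 2 := by
  haveI := W.isElliptic_quadraticTwist hd
  have hc0 : (D.c : ℂ) ≠ 0 := D.cast_c_ne_zero
  have hc0' : (D'.c : ℂ) ≠ 0 := D'.cast_c_ne_zero
  have hcq : (D.c : ℚ) ≠ 0 := by exact_mod_cast (Int.cast_ne_zero.mp hc0)
  have hcq' : (D'.c : ℚ) ≠ 0 := by exact_mod_cast (Int.cast_ne_zero.mp hc0')
  have ht : (D.c : ℂ) * s / (D'.c : ℂ) ≠ 0 := div_ne_zero (mul_ne_zero hc0 hs0) hc0'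
  have ht' : (D'.c : ℂ) * s / (D.c : ℂ) ≠ 0 := div_ne_zero (mul_ne_zero hc0' hs0) hc0
  obtain ⟨-, hm'⟩ := optimal_flip_relIndex_eq hNN D D' hD hD' hd hs0 hs hpr ha h1 h2 hcoef hflip ht ht'
  -- the Néron-type pair `Λ_T = s⁻¹Λ_W` of `T = W ⊗ d`
  have hT := isNeronLatticeOf_quadraticTwist_of_sq_eq d D.isNeronLattice hs0 hs
  -- the engine's inclusion `(c′s/c)Λ_W ⊆ Λ_{W′}` is `r·Λ_T ⊆ Λ_{W′}` with `r = c′d/c ∈ ℚ`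
  set r : ℚ := (D'.c : ℚ) * d / (D.c : ℚ) with hr_def
  have hrq : r ≠ 0 := div_ne_zero (mul_ne_zero hcq' hd) hcq
  have hr : ((r : ℚ) : ℂ) ≠ 0 := by exact_mod_cast hrq
  have hΛeq : ((D.L.mulLeft s⁻¹ (inv_ne_zero hs0)).mulLeft _ hr).lattice =
      (D.L.mulLeft ((D'.c : ℂ) * s / (D.c : ℂ)) ht').lattice := by
    ext x
    simp only [PeriodPair.mem_mulLeft_lattice, inv_inv]
    have hrc : ((r : ℚ) : ℂ) = (D'.c : ℂ) * s ^ 2 / (D.c : ℂ) := by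
      rw [hr_def, hs]; push_cast; ring
    have hscal : s * (((r : ℚ) : ℂ))⁻¹ = ((D'.c : ℂ) * s / (D.c : ℂ))⁻¹ := by
      rw [hrc]; field_simp
    rw [← mul_assoc, hscal]
  have hler : ((D.L.mulLeft s⁻¹ (inv_ne_zero hs0)).mulLeft _ hr).lattice ≤ D'.L.lattice := by
    rw [hΛeq]; exact mulLeft_lattice_le_of_optimal D' D hD h2 ht'
  have hidxr : ((D.L.mulLeft s⁻¹ (inv_ne_zero hs0)).mulLeft _ hr).lattice.toAddSubgroup.relIndex
      D'.L.lattice.toAddSubgroup = a := by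
    rw [hΛeq]; exact hm'
  -- the isogeny's rational multiplier
  obtain ⟨q, hq, hleq, hidxq⟩ :=
    exists_rat_mulLeft_lattice_le_of_isogeny (W.quadraticTwist d) W' hT D'.isNeronLattice φ
  have key := relIndex_ratCast_mul_sq_eq hq hr hleq hler
  rw [hidxq, hidxr] at key
  have keyQ : (φ.degree : ℚ) * r ^ 2 = a * q ^ 2 := by exact_mod_cast key
  exact nat_eq_prime_mul_sq_of_rat hpr (x := q / r)
    (by rw [div_pow, mul_div_assoc', eq_div_iff (pow_ne_zero 2 hrq), keyQ])

/-- **OFF THE MAZUR PRIMES THERE ARE NO FLIPS** (granted Mazur–Kenku).  Same hypotheses, `a` prime with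
`a ∉ mazurPrimes = {2, 3, 5, 7, 11, 13, 17, 19, 37, 43, 67, 163}` and `W ⊗ d ~ W′` over `ℚ`: a flip would
make every `ℚ`-isogeny degree `a·k²`, but Mazur–Kenku provides one of degree in Kenku's list, whose prime
divisors are Mazur primes.  Hence `∃ u, u • (W ⊗ d) = W′` — Edixhoven's proportionality `Λ̃ ∝ Λ` holds.
[cite: Mazur1978, Thm 1] [cite: Kenku1982] [cite: SilvermanAEC2009, IX.6 Example 6.4] [cite: Edixhoven1991, §4] -/
theorem optimal_orbit_commutes_of_not_mem_mazurPrimes (hMK : mazurKenku_exists_cyclic_isogeny)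
    {W W' : WeierstrassCurve ℚ} [W.IsElliptic] [W'.IsElliptic]
    {N N' : ℕ} [NeZero N] [NeZero N'] (hNN : N' = N) (D : ModularParametrizationData W N)
    (D' : ModularParametrizationData W' N') (hD : IsLatticeOptimal D) (hD' : IsLatticeOptimal D')
    {d : ℚ} (hd : d ≠ 0) {s : ℂ} (hs0 : s ≠ 0) (hs : s ^ 2 = (d : ℂ)) {a : ℕ} (hpr : a.Prime)
    (hMaz : a ∉ mazurPrimes) (ha : ‖s‖ ^ 2 = a)
    (h1 : ∀ w ∈ periodLattice D'.f, s * w ∈ periodLattice D.f)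
    (h2 : ∀ w ∈ periodLattice D.f, s * w ∈ periodLattice D'.f)
    (hcoef : ∀ n : ℕ, ‖cuspCoeff D'.f n‖ = ‖cuspCoeff D.f n‖)
    (hiso : IsIsogenous (W.quadraticTwist d) W') :
    ∃ u : VariableChange ℚ, u • W.quadraticTwist d = W' := by
  haveI := W.isElliptic_quadraticTwist hd
  by_contra hne
  push Not at hne
  obtain ⟨ψ, -, hψ⟩ := hMK (W.quadraticTwist d) W' hiso
  obtain ⟨k, hk⟩ := optimal_flip_isogeny_degree hNN D D' hD hD' hd hs0 hs hpr ha h1 h2 hcoef hne ψ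
  exact hMaz (mem_mazurPrimes_of_prime_dvd_of_mem_kenkuDegrees hpr hψ ⟨k ^ 2, hk⟩)

/-- The `q*`-instance: for a prime `q ∉ mazurPrimes` (so `q ≥ 23`, `q ∉ {37, 43, 67, 163}`) with `q² ∣ N`,
both data lattice-optimal at the common conductor and `W ⊗ q* ~ W′`: **the orbit commutes**,
`∃ u, u • (W ⊗ q*) = W′` (granted Mazur–Kenku). [cite: Mazur1978, Thm 1] [cite: Edixhoven1991, §4] -/
theorem pStar_optimal_orbit_commutes_of_not_mem_mazurPrimes (hMK : mazurKenku_exists_cyclic_isogeny)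
    {q : ℕ} (hq : q.Prime) (hMaz : q ∉ mazurPrimes) :
    ∀ (W W' : WeierstrassCurve ℚ) [W.IsElliptic] [W'.IsElliptic] [NeZero (W.conductorNorm ℤ)]
      [NeZero (W'.conductorNorm ℤ)] (D : ModularParametrizationData W (W.conductorNorm ℤ))
      (D' : ModularParametrizationData W' (W'.conductorNorm ℤ)),
      IsLatticeOptimal D → IsLatticeOptimal D' →
      q ^ 2 ∣ W.conductorNorm ℤ → W'.conductorNorm ℤ = W.conductorNorm ℤ →
      IsIsogenous (W.quadraticTwist ((((-1 : ℤ) ^ (q / 2) * q : ℤ)) : ℚ)) W' →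
      ∃ u : VariableChange ℚ, u • W.quadraticTwist ((((-1 : ℤ) ^ (q / 2) * q : ℤ)) : ℚ) = W' := by
  intro W W' _ _ _ _ D D' hD hD' hM hN hiso
  haveI : Fact q.Prime := ⟨hq⟩
  have hq2 : q ≠ 2 := by rintro rfl; exact hMaz (by decide)
  set d : ℤ := (-1 : ℤ) ^ (q / 2) * q with hd
  have hdZ : d ≠ 0 := mul_ne_zero (pow_ne_zero _ (by norm_num)) (by exact_mod_cast hq.ne_zero)
  have hd0 : (d : ℚ) ≠ 0 := by exact_mod_cast hdZ
  set G : ℂ := gaussSum ((quadraticChar (ZMod q)).ringHomComp (Int.castRingHom ℂ))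
    (ZMod.stdAddChar (N := q)) with hGdef
  have hG2 : G ^ 2 = ((d : ℚ) : ℂ) := by
    rw [hGdef, gaussSum_quadraticChar_ringHomComp_sq q hq2, hd]
    push_cast
    ring
  have hG0 : G ≠ 0 := by
    intro h0
    have : ((d : ℚ) : ℂ) = 0 := by rw [← hG2, h0]; simp
    exact hd0 (by exact_mod_cast this)
  have hGa : ‖G‖ ^ 2 = q := by
    rw [← norm_pow, hG2, hd]
    push_cast
    rw [norm_mul, norm_pow, norm_neg, norm_one, one_pow, one_mul, Complex.norm_natCast]
  obtain ⟨h1, h2, hcoef⟩ := pStar_orbit_steps hq2 D D' hM hN hiso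
  exact optimal_orbit_commutes_of_not_mem_mazurPrimes hMK hN D D' hD hD' hd0 hG0 hG2 hq hMaz hGa h1 h2
    hcoef hiso

/-- The `q*`-instance of `optimal_flip_isogeny_degree`: `q` odd prime, `q² ∣ N`, both data lattice-optimal
at the common conductor, `W ⊗ q* ~ W′` and NO `ℚ`-isomorphism `u • (W ⊗ q*) = W′` ⇒ every `ℚ`-isogeny
`W ⊗ q* → W′` has degree `q·k²`. [cite: SilvermanAEC2009, Thm. VI.4.1(b)] [cite: Stevens1989, (5.4)–(5.5)] -/
theorem pStar_optimal_flip_isogeny_degree {q : ℕ} (hq : q.Prime) (hq2 : q ≠ 2)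
    {W W' : WeierstrassCurve ℚ} [W.IsElliptic] [W'.IsElliptic] [NeZero (W.conductorNorm ℤ)]
    [NeZero (W'.conductorNorm ℤ)] (D : ModularParametrizationData W (W.conductorNorm ℤ))
    (D' : ModularParametrizationData W' (W'.conductorNorm ℤ)) (hD : IsLatticeOptimal D)
    (hD' : IsLatticeOptimal D') (hM : q ^ 2 ∣ W.conductorNorm ℤ)
    (hN : W'.conductorNorm ℤ = W.conductorNorm ℤ)
    (hiso : IsIsogenous (W.quadraticTwist ((((-1 : ℤ) ^ (q / 2) * q : ℤ)) : ℚ)) W')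
    (hflip : ∀ u : VariableChange ℚ, u • W.quadraticTwist ((((-1 : ℤ) ^ (q / 2) * q : ℤ)) : ℚ) ≠ W')
    (φ : Isogeny (W.quadraticTwist ((((-1 : ℤ) ^ (q / 2) * q : ℤ)) : ℚ)) W') :
    ∃ k : ℕ, φ.degree = q * k ^ 2 := by
  haveI : Fact q.Prime := ⟨hq⟩
  have hdZ : ((-1 : ℤ) ^ (q / 2) * q : ℤ) ≠ 0 :=
    mul_ne_zero (pow_ne_zero _ (by norm_num)) (by exact_mod_cast hq.ne_zero)
  have hd0 : ((((-1 : ℤ) ^ (q / 2) * q : ℤ)) : ℚ) ≠ 0 := by exact_mod_cast hdZ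
  have hG2 : gaussSum ((quadraticChar (ZMod q)).ringHomComp (Int.castRingHom ℂ))
      (ZMod.stdAddChar (N := q)) ^ 2 = (((((-1 : ℤ) ^ (q / 2) * q : ℤ)) : ℚ) : ℂ) := by
    rw [gaussSum_quadraticChar_ringHomComp_sq q hq2]
    push_cast
    ring
  have hG0 : gaussSum ((quadraticChar (ZMod q)).ringHomComp (Int.castRingHom ℂ))
      (ZMod.stdAddChar (N := q)) ≠ 0 := by
    intro h0
    have : (((((-1 : ℤ) ^ (q / 2) * q : ℤ)) : ℚ) : ℂ) = 0 := by rw [← hG2, h0]; simp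
    exact hd0 (by exact_mod_cast this)
  have hGa : ‖gaussSum ((quadraticChar (ZMod q)).ringHomComp (Int.castRingHom ℂ))
      (ZMod.stdAddChar (N := q))‖ ^ 2 = q := by
    rw [← norm_pow, hG2]
    push_cast
    rw [norm_mul, norm_pow, norm_neg, norm_one, one_pow, one_mul, Complex.norm_natCast]
  obtain ⟨h1, h2, hcoef⟩ := pStar_orbit_steps hq2 D D' hM hN hiso
  exact optimal_flip_isogeny_degree hN D D' hD hD' hd0 hG0 hG2 hq hGa h1 h2 hcoef hflip φ

/-- **FLIP ⟺ EVERY `ℚ`-ISOGENY `W ⊗ q* → W′` HAS DEGREE `q·k²`** (⟺ none has square degree): the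
isogeny-degree CHARACTERISATION of the flip bit on a same-conductor optimal `q*`-orbit, `q` odd, `q² ∣ N`.
(→) is `pStar_optimal_flip_isogeny_degree`; (←): a `ℚ`-isomorphism `u • (W ⊗ q*) = W′` makes every
`ℚ`-isogeny degree a square (`isogeny_degree_eq_sq_of_smul_eq`), and `q·k′² = k²` contradicts `q` prime.
No §23 scaling, no Mazur–Kenku. [cite: SilvermanAEC2009, Thm. VI.4.1(b)] [cite: Pal2012, Lemma 3.1] -/
theorem pStar_optimal_flip_iff_isogeny_degree {q : ℕ} (hq : q.Prime) (hq2 : q ≠ 2)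
    {W W' : WeierstrassCurve ℚ} [W.IsElliptic] [W'.IsElliptic] [NeZero (W.conductorNorm ℤ)]
    [NeZero (W'.conductorNorm ℤ)] (D : ModularParametrizationData W (W.conductorNorm ℤ))
    (D' : ModularParametrizationData W' (W'.conductorNorm ℤ)) (hD : IsLatticeOptimal D)
    (hD' : IsLatticeOptimal D') (hM : q ^ 2 ∣ W.conductorNorm ℤ)
    (hN : W'.conductorNorm ℤ = W.conductorNorm ℤ)
    (hiso : IsIsogenous (W.quadraticTwist ((((-1 : ℤ) ^ (q / 2) * q : ℤ)) : ℚ)) W') :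
    (∀ u : VariableChange ℚ, u • W.quadraticTwist ((((-1 : ℤ) ^ (q / 2) * q : ℤ)) : ℚ) ≠ W') ↔
      ∀ φ : Isogeny (W.quadraticTwist ((((-1 : ℤ) ^ (q / 2) * q : ℤ)) : ℚ)) W',
        ∃ k : ℕ, φ.degree = q * k ^ 2 := by
  refine ⟨fun hflip φ ↦ pStar_optimal_flip_isogeny_degree hq hq2 D D' hD hD' hM hN hiso hflip φ,
    fun hdeg u hu ↦ ?_⟩
  haveI : Fact q.Prime := ⟨hq⟩
  have hdZ : ((-1 : ℤ) ^ (q / 2) * q : ℤ) ≠ 0 :=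
    mul_ne_zero (pow_ne_zero _ (by norm_num)) (by exact_mod_cast hq.ne_zero)
  have hd0 : ((((-1 : ℤ) ^ (q / 2) * q : ℤ)) : ℚ) ≠ 0 := by exact_mod_cast hdZ
  have hG2 : gaussSum ((quadraticChar (ZMod q)).ringHomComp (Int.castRingHom ℂ))
      (ZMod.stdAddChar (N := q)) ^ 2 = (((((-1 : ℤ) ^ (q / 2) * q : ℤ)) : ℚ) : ℂ) := by
    rw [gaussSum_quadraticChar_ringHomComp_sq q hq2]
    push_cast
    ring
  have hG0 : gaussSum ((quadraticChar (ZMod q)).ringHomComp (Int.castRingHom ℂ))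
      (ZMod.stdAddChar (N := q)) ≠ 0 := by
    intro h0
    have : (((((-1 : ℤ) ^ (q / 2) * q : ℤ)) : ℚ) : ℂ) = 0 := by rw [← hG2, h0]; simp
    exact hd0 (by exact_mod_cast this)
  haveI := W.isElliptic_quadraticTwist hd0
  have hT := isNeronLatticeOf_quadraticTwist_of_sq_eq ((((-1 : ℤ) ^ (q / 2) * q : ℤ)) : ℚ)
    D.isNeronLattice hG0 hG2
  obtain ⟨φ⟩ := hiso
  obtain ⟨k, hk⟩ := isogeny_degree_eq_sq_of_smul_eq hT D'.isNeronLattice u hu φ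
  obtain ⟨k', hk'⟩ := hdeg φ
  have hk'0 : k' ≠ 0 := by
    rintro rfl
    have hpos := φ.degree_pos
    rw [hk'] at hpos
    simp at hpos
  have hnat : q * k' ^ 2 = k ^ 2 := hk'.symm.trans hk
  have hQ : (q : ℚ) * (k' : ℚ) ^ 2 = (k : ℚ) ^ 2 := by exact_mod_cast hnat
  have hk'Q : (k' : ℚ) ≠ 0 := by exact_mod_cast hk'0
  have hsq : IsSquare ((q : ℕ) : ℚ) :=
    ⟨(k : ℚ) / k', by rw [← sq, div_pow, eq_div_iff (pow_ne_zero _ hk'Q), hQ]⟩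
  exact hq.prime.not_isSquare (Rat.isSquare_natCast_iff.mp hsq)

/-! ### Typed leaves (E-an-29 / E-an-30) and their closers -/

/-- **E-an-29 — FLIP ⇒ ISOGENY DEGREES `p·k²`** (typed leaf, PROVED below): for an odd prime `p` with
`p² ∣ N(E)`, `E`, `E′` the lattice-optimal curves (at their common conductor) of the classes of `W` and of
`W ⊗ p*`, if `E ⊗ p*` and `E′` are NOT `ℚ`-isomorphic then every `ℚ`-isogeny `E ⊗ p* → E′` has degree
`p·k²` (`k ≥ 1`); in particular the minimal isogeny degree between them is `p·k²`, never a square.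
BC5: minimal degree = `p` exactly on all 23 532 odd-`p` flip rows of TWISTCENSUS2 v1 (p = 3: 21 774,
5: 1 542, 7: 122, 11: 74, 17: 20), on all 1 983 odd CM self-twist rows (non-commuting; p = 3: 1 848, 7: 54,
11: 37, 19: 23, 43: 11, 67: 7, 163: 3) and = 1 on all 667 706 commuting rows.
[cite: SilvermanAEC2009, Thm. VI.4.1(b)] [cite: Pal2012, Lemma 3.1] [cite: Stevens1989, (5.4)–(5.5)] -/
@[conjecture] def RamifiedTwistFlipIsogenyDegree (p : ℕ) : Prop :=
  p.Prime → p ≠ 2 →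
  ∀ (W W' : WeierstrassCurve ℚ) [W.IsElliptic] [W'.IsElliptic] [NeZero (W.conductorNorm ℤ)]
    [NeZero (W'.conductorNorm ℤ)] (D : ModularParametrizationData W (W.conductorNorm ℤ))
    (D' : ModularParametrizationData W' (W'.conductorNorm ℤ)),
    (∀ z ∈ D.L.lattice, ∃ w ∈ periodLattice D.f, z = D.c * w) →
    (∀ z ∈ D'.L.lattice, ∃ w ∈ periodLattice D'.f, z = D'.c * w) →
    p ^ 2 ∣ W.conductorNorm ℤ → W'.conductorNorm ℤ = W.conductorNorm ℤ →
    IsIsogenous (W.quadraticTwist ((((-1 : ℤ) ^ (p / 2) * p : ℤ)) : ℚ)) W' →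
    (∀ u : VariableChange ℚ, u • W.quadraticTwist ((((-1 : ℤ) ^ (p / 2) * p : ℤ)) : ℚ) ≠ W') →
    ∀ φ : Isogeny (W.quadraticTwist ((((-1 : ℤ) ^ (p / 2) * p : ℤ)) : ℚ)) W', ∃ k : ℕ, φ.degree = p * k ^ 2

/-- E-an-29 holds (§24 index engine + *AEC* VI.4.1(b)). -/
theorem ramifiedTwistFlipIsogenyDegree_holds (p : ℕ) : RamifiedTwistFlipIsogenyDegree p := by
  intro hp hp2 W W' _ _ _ _ D D' hD hD' hM hN hiso hflip φ
  exact pStar_optimal_flip_isogeny_degree hp hp2 D D' hD hD' hM hN hiso hflip φ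

/-- **E-an-30 — OFF THE MAZUR PRIMES, OPTIMALITY COMMUTES WITH THE `p*`-TWIST** (typed leaf, PROVED below
from the tree's NAMED FACT `mazurKenku_exists_cyclic_isogeny`): for a prime
`p ∉ {2, 3, 5, 7, 11, 13, 17, 19, 37, 43, 67, 163}` with `p² ∣ N(E)`, the lattice-optimal curve `E′` of the
class of `E ⊗ p*` (same conductor) is `ℚ`-isomorphic to `E ⊗ p*`, `E` the lattice-optimal curve of its class
— Edixhoven's 1991 proportionality `Λ̃ ∝ Λ` as a THEOREM there; hence (§23) `deg φ′ = p^{±1}·deg φ` and the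
Manin-shift identity of §24 on EVERY such orbit.  BC5 (TWISTCENSUS2 v1, same conductor, N ≤ 500 000):
every non-commuting row at p ≥ 11 sits at a MAZUR prime — non-CM flips at p = 11 (74), 17 (20), CM self-twists
at p = 11, 19, 43, 67, 163 (37, 23, 11, 7, 3 rows), isodeg = p on each — and the 26 830 rows at the 76 primes
23 ≤ p ≤ 673 outside the list ALL commute (0 exceptions). [cite: Mazur1978, Thm 1] [cite: Kenku1982] [cite: SilvermanAEC2009, IX.6 Example 6.4]
[cite: Edixhoven1991, §4] -/
@[conjecture] def RamifiedTwistCommutesOffMazurPrimes (p : ℕ) : Prop :=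
  mazurKenku_exists_cyclic_isogeny → p.Prime → p ∉ mazurPrimes →
  ∀ (W W' : WeierstrassCurve ℚ) [W.IsElliptic] [W'.IsElliptic] [NeZero (W.conductorNorm ℤ)]
    [NeZero (W'.conductorNorm ℤ)] (D : ModularParametrizationData W (W.conductorNorm ℤ))
    (D' : ModularParametrizationData W' (W'.conductorNorm ℤ)),
    (∀ z ∈ D.L.lattice, ∃ w ∈ periodLattice D.f, z = D.c * w) →
    (∀ z ∈ D'.L.lattice, ∃ w ∈ periodLattice D'.f, z = D'.c * w) →
    p ^ 2 ∣ W.conductorNorm ℤ → W'.conductorNorm ℤ = W.conductorNorm ℤ →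
    IsIsogenous (W.quadraticTwist ((((-1 : ℤ) ^ (p / 2) * p : ℤ)) : ℚ)) W' →
    ∃ u : VariableChange ℚ, u • W.quadraticTwist ((((-1 : ℤ) ^ (p / 2) * p : ℤ)) : ℚ) = W'

/-- E-an-30 holds (§25 + Mazur–Kenku as a hypothesis inside the statement). -/
theorem ramifiedTwistCommutesOffMazurPrimes_holds (p : ℕ) : RamifiedTwistCommutesOffMazurPrimes p := by
  intro hMK hp hMaz W W' _ _ _ _ D D' hD hD' hM hN hiso
  exact pStar_optimal_orbit_commutes_of_not_mem_mazurPrimes hMK hp hMaz W W' D D' hD hD' hM hN hiso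

/-- **E-imc-1b OFF THE MAZUR PRIMES reduces to its commuting case**: granted Mazur–Kenku, for a prime
`p ∉ mazurPrimes` the Manin-valuation invariance `v_p(c′) = v_p(c)` on ALL same-conductor `p*`-orbits
(`RamifiedTwistManinInvariance p`, E-imc-1b) follows from the invariance on COMMUTING orbits
(`CommutingOrbitManinValEq p`) — there are no other orbits. [cite: Mazur1978, Thm 1] [cite: Edixhoven1991, §4] -/
theorem ramifiedTwistManinInvariance_of_commuting_of_not_mem_mazurPrimes
    (hMK : mazurKenku_exists_cyclic_isogeny) {p : ℕ} (hMaz : p ∉ mazurPrimes)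
    (hV : CommutingOrbitManinValEq p) : RamifiedTwistManinInvariance p := by
  intro W W' _ _ _ _ _ _ D D' hp hp2 hD hD' hM hN hiso
  obtain ⟨u, hu⟩ :=
    pStar_optimal_orbit_commutes_of_not_mem_mazurPrimes hMK hp hMaz W W' D D' hD hD' hM hN hiso
  exact hV W W' u D D' hD hD' hM hN hu

end CovolumeEngine

end Summit.BirchSwinnertonDyer.Rank1Residual.ManinAdditive

end
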